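import Summits.BirchSwinnertonDyer.BirchSwinnertonDyer.Theorems.SylvesterTwoHeegnerIndexCoupledTelescopeCurvePackage
import Summits.BirchSwinnertonDyer.BirchSwinnertonDyer.Theorems.SylvesterTwoHeegnerIndexCoupledTelescopeLiftFamilyTree
import Summits.BirchSwinnertonDyer.BirchSwinnertonDyer.Theorems.SylvesterTwoHeegnerIndexCoupledTelescopeValueCutPair
import Summits.BirchSwinnertonDyer.BirchSwinnertonDyer.Theorems.SylvesterTwoHeegnerIndexCoupledTelescopeTailBlock
import Summits.BirchSwinnertonDyer.BirchSwinnertonDyer.Theorems.SylvesterTwoHeegnerIndexCoupledTelescopeTailSevenKappa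
import HarnessLib

/-!
# The COUPLED Cassels–Tate telescope, XVII: `stub_tailSeven` VERBATIM from ONE rows' display hR
# (RESIDUE 7) and the displayed inputs VII / H3 / LP (instantiation lane assembled; D620–D639)

Crux `UpperOffV0HSYPlus` (stmt-BirchSwinnertonDyer-19804), skeleton VARIANT M (406ca288e244d392), stub
`stub_tailSeven`; census theorem of record `tailSeven_of_coupledTelescope_of_leaves_kappa (hT^κ)`.
This file PROVES hT^κ from a smaller display: every (T-L4)/LIFT/ISOTROPY/(T-L2)-value conjunct is
discharged by the tree-currency files XIII–XVII-a (one-φ package p708199, lift family p708738, value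
cut XV′ `…ValueCutPair` (𝒪-line form, D646), curve package, tail block) on the CONSTRUCTED pairing, and the stub follows VERBATIM (the
167-line hT^κ is the GOAL after `refine`, never restated).  Displayed: `VII` = clause (vii) of
`casselsTate_canonical_adjoint` for every quadratic `K` (the ONE printed pairing input, Fisher 2003
Prop. 2.16; D636); `H3` = `Ш³(F, μ_n) = 0` and `LP` = the LEVEL property of Milne's recipe on the
canonical family (cone-interim: the types of the cone's `VisiblePairAtTwo.shaThree_mu_eq_zero` /
`isLevelPairing_ctLevelPairing_canonical_of_alt`; D590/D635); `hR = RESIDUE` = the ROWS' contract —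
(T-L5) provenance `Y ↦ 2^M₀ x₀ + T`, `2M₀ ≤ ord₂(qB·qA)`; then for EVERY level `κ ≥ max(M₀,1)`, every
pinned one-φ datum and every Weil datum: the level's Kolyvagin primes, admissible sets (`0 ∈ Adm`,
`res Sel_ℚ ⊆ Adm`), the bottom class `x = δ x₀` of exact order with `c_B 1 = 2^M₀ x`, the classes with
(T-L1) FLIPs / Selmer-away-from-`λm` (McCallum 4.3) / Kolyvagin-prime level, the (T-L2)′ LOCAL leaves
in 𝒪-LINE form (McCallum 5.3 at level `κ`, D646), the (T-L3) mixed Čebotarev clause, and the `ℚ`-Kummer five per curve.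
HONEST LABEL: CONDITIONAL closure of `stub_tailSeven` modulo {VII, H3, LP, RESIDUE}; ledger stub NOT closed;
hR's leaves are the rows', NOT claimed; nothing asserted on 19804; X12.CMAtTwo NOT proved; BSD not claimed.
Theorem-only.  Twin: `…TailFourOfResidue`.  Sources: McCallum 1991 §4–§5; Gross 1991; Milne ADT I §6.
-/

-- every Summits module is named `Summit.<Summit>.<Problem>…`: the duplicated component is by design
set_option linter.dupNamespace false
set_option autoImplicit false

noncomputable section

open scoped Classical AddSubgroup

open WeierstrassCurve Literature.NumberTheory.EllipticCurves Field NumberField IsDedekindDomain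
  Literature.NumberTheory.GaloisRepresentations Literature.NumberTheory.GaloisCohomology
  Literature.GroupTheory.FiniteAbelian Literature.NumberTheory.EllipticCurves.KolyvaginDescent
  Literature.NumberTheory.EllipticCurves.HuShuYin2019
open Literature.NumberTheory.GaloisRepresentations.DiscreteGaloisModule (mu)
open Summit.BirchSwinnertonDyer.BirchSwinnertonDyer.Theses.SylvesterTwoHeegnerIndex
  hiding HSYPointTwoDivisibleSevenModNine

namespace Summit.BirchSwinnertonDyer.BirchSwinnertonDyer.Theorems.SylvesterTwoCoupledTelescope

set_option maxHeartbeats 1200000 in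
/-- **`stub_tailSeven` VERBATIM from the RESIDUE display hR and the displayed inputs VII / H3 / LP**
(module docstring): hT^κ(7) is assembled from hR by the instantiation files XIII–XVII-a and fed to
the census theorem `tailSeven_of_coupledTelescope_of_leaves_kappa` (p704180/p704241).  CONDITIONAL closure; the
ledger stub is NOT closed; hR's leaves are the rows'. [cite: McCallumLMS1991, §1 Theorem; §5 Thm. 5.4, Cor. 5.6]
[cite: GrossLMS1991, §3–§5] [cite: Fisher2003, Prop. 2.16 (JNT 98, p. 132)] -/
theorem tailSeven_of_residue
    -- VII = clause (vii) of `casselsTate_canonical_adjoint` VERBATIM for every quadratic `K` (D636)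
    (hvii : ∀ (K : Type) [Field K] [NumberField K] (σ₀ : K ≃ₐ[ℚ] K) (h2 : Module.finrank ℚ K = 2)
      (hσ₀ : σ₀ ≠ 1),
      ∀ (W : WeierstrassCurve ℚ) [W.IsElliptic] (m : ℕ) [NeZero m]
      (eℚ : geomTorsion W ((m * m : ℕ) : ℤ) → geomTorsion W ((m * m : ℕ) : ℤ) → AlgebraicClosure ℚ)
      (hμ : ∀ S T, eℚ S T ^ (m * m) = 1)
      (hadd₁ : ∀ S₁ S₂ T, eℚ (S₁ + S₂) T = eℚ S₁ T * eℚ S₂ T)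
      (hadd₂ : ∀ S T₁ T₂, eℚ S (T₁ + T₂) = eℚ S T₁ * eℚ S T₂)
      (hgal : ∀ (σ : absoluteGaloisGroup ℚ) (S T : geomTorsion W ((m * m : ℕ) : ℤ)),
        σ • eℚ S T = eℚ (σ • S) (σ • T))
      (eK : geomTorsion (W.baseChange K) ((m * m : ℕ) : ℤ) →
        geomTorsion (W.baseChange K) ((m * m : ℕ) : ℤ) → AlgebraicClosure K)
      (hμK : ∀ S T, eK S T ^ (m * m) = 1)
      (hadd₁K : ∀ S₁ S₂ T, eK (S₁ + S₂) T = eK S₁ T * eK S₂ T)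
      (hadd₂K : ∀ S T₁ T₂, eK S (T₁ + T₂) = eK S T₁ * eK S T₂)
      (hgalK : ∀ (σ : absoluteGaloisGroup K) (S T : geomTorsion (W.baseChange K) ((m * m : ℕ) : ℤ)),
        σ • eK S T = eK (σ • S) (σ • T)),
      (∀ T, eℚ T T = 1) → (∀ T, (∀ S, eℚ S T = 1) → T = 0) →
      (∀ T, eK T T = 1) → (∀ T, (∀ S, eK S T = 1) → T = 0) →
      (∀ (S T : geomTorsion W ((m * m : ℕ) : ℤ)) (S' T' : geomTorsion (W.baseChange K) ((m * m : ℕ) : ℤ)),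
        (S' : geomPoints (W.baseChange K)) = geomPointsEquivBaseChange K W S →
        (T' : geomPoints (W.baseChange K)) = geomPointsEquivBaseChange K W T →
        (eK S' T' : AlgebraicClosure K) = closureEmb (K := ℚ) K (eℚ S T)) →
      ∀ (a : W.galH1) (c : (W.baseChange K).galH1), a ∈ W.sha → c ∈ (W.baseChange K).sha →
        (m : ℤ) • a = 0 → (m : ℤ) • c = 0 → corBaseChange K W σ₀ h2 hσ₀ c ∈ W.sha →
        ctGeneralFun (W.baseChange K) m eK hμK hadd₁K hadd₂K hgalK (LocalInvariants.canonical K (m * m))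
            (resBaseChange W K a) c =
          ctGeneralFun W m eℚ hμ hadd₁ hadd₂ hgal (LocalInvariants.canonical ℚ (m * m))
            a (corBaseChange K W σ₀ h2 hσ₀ c))
    -- H3 = `Ш³(F, μ_n) = 0` (cone-interim, displayed; the cone's `VisiblePairAtTwo.shaThree_mu_eq_zero`)
    (hH3 : ∀ (F : Type) [Field F] [NumberField F] (n : ℕ) [NeZero n] (c : galoisCohomology (mu F n) 3),
      (∀ v : Place F, galoisCohomology.localization (mu F n) v 3 c = 0) → c = 0)
    -- LP = the cone's `isLevelPairing_ctLevelPairing_canonical_of_alt`, fully quantified (cone-interim)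
    (hLP : ∀ (K : Type) [Field K] [NumberField K] (W : WeierstrassCurve K) [W.IsElliptic] (p k : ℕ)
      [Fact p.Prime]
      (e : geomTorsion W ((p ^ k * p ^ k : ℕ) : ℤ) → geomTorsion W ((p ^ k * p ^ k : ℕ) : ℤ) →
        AlgebraicClosure K)
      (hμ : ∀ S T, e S T ^ (p ^ k * p ^ k) = 1)
      (hadd₁ : ∀ S₁ S₂ T, e (S₁ + S₂) T = e S₁ T * e S₂ T)
      (hadd₂ : ∀ S T₁ T₂, e S (T₁ + T₂) = e S T₁ * e S T₂)
      (hgal : ∀ (σ : absoluteGaloisGroup K) (S T : geomTorsion W ((p ^ k * p ^ k : ℕ) : ℤ)),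
        σ • e S T = e (σ • S) (σ • T))
      (halt : ∀ T, e T T = 1) (hnd : ∀ T, (∀ S, e S T = 1) → T = 0)
      [NeZero (p ^ k)] [NeZero (p ^ k * p ^ k)], 0 < k →
      (∀ a ∈ W.sha, ((p ^ k : ℕ) : ℤ) • a = 0 →
        ctGeneralFun W (p ^ k) e hμ hadd₁ hadd₂ hgal (LocalInvariants.canonical K (p ^ k * p ^ k)) a a = 0) →
      ∀ (hH3' : ∀ c : galoisCohomology (mu K (p ^ k * p ^ k)) 3,
        (∀ v : Place K, galoisCohomology.localization (mu K (p ^ k * p ^ k)) v 3 c = 0) → c = 0),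
      IsLevelPairing (p ^ k)
        (ctLevelPairing W (p ^ k) e hμ hadd₁ hadd₂ hgal (LocalInvariants.canonical K (p ^ k * p ^ k)) halt
          (sumInvLocalizationEqZero_canonical_of_numberField K (p ^ k * p ^ k)) hH3'
          (localTerm_finite_support W (p ^ k) e hμ hadd₁ hadd₂ hgal halt
            (LocalInvariants.canonical K (p ^ k * p ^ k)))))
    -- hR = RESIDUE 7: THE ROWS' CONTRACT
    (hR : PublishedFactsTwoPlus →
      ∀ (p : ℕ), p.Prime → p % 9 = 7 → (¬ ∃ x : ZMod p, x ^ 3 = 3) →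
        ∀ (A B : WeierstrassCurve ℚ) [A.IsElliptic] [A.IsGloballyMinimal] [B.IsElliptic]
          [B.IsGloballyMinimal], (∃ C : VariableChange ℚ, C • B = HuShuYin2019.cubeSumCurve (p : ℚ)) →
          (∃ C : VariableChange ℚ, C • A = HuShuYin2019.cubeSumCurve (3 * (p : ℚ) ^ 2)) →
          4 < Nat.card (AddCommGroup.primaryComponent B.sha 2) *
              Nat.card (AddCommGroup.primaryComponent A.sha 2) →
          ∀ (qB qA : ℚ), shaAn B = (qB : ℂ) → shaAn A = (qA : ℂ) → qB * qA ≠ 0 →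
          ∀ (K : Type) [Field K] [NumberField K] (ω : K), ω ^ 2 + ω + 1 = 0 →
            Module.finrank ℚ K = 2 →
          ∀ (CB : VariableChange ℚ) (hCB : CB • B = HuShuYin2019.cubeSumCurve (p : ℚ))
            (P : B.toAffine.Point) (Y : (B.baseChange K).toAffine.Point),
            ¬ IsOfFinAddOrder (WeierstrassCurve.QuadraticDescent.incl K B P) →
            (∀ Q : B.toAffine.Point, ∃ m : ℤ, IsOfFinAddOrder
              (WeierstrassCurve.QuadraticDescent.incl K B Q -
                m • WeierstrassCurve.QuadraticDescent.incl K B P)) →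
            ((qB * qA : ℚ) : ℝ) *
                WeierstrassCurve.Affine.Point.canonicalHeight (WeierstrassCurve.QuadraticDescent.incl K B P) =
              (2 : ℝ) ^ (if p % 9 = 4 then (0 : ℤ) else -2) *
                WeierstrassCurve.Affine.Point.canonicalHeight Y →
          -- THE RESIDUE: provenance, then for every level `κ ≥ max(M₀, 1)`, every pinned one-φ datum
          -- and every Weil datum, the rows' level-`κ` leaves
          ∃ (M₀ : ℕ) (x₀ T : ((cubeSumCurve (p : ℚ)).baseChange K).toAffine.Point),
          IsOfFinAddOrder T ∧
          Affine.Point.congrEquiv (congrArg (fun W : WeierstrassCurve ℚ ↦ W.baseChange K) hCB)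
              (VariableChange.pointEquivBaseChange B CB K Y) = ((2 ^ M₀ : ℕ) : ℤ) • x₀ + T ∧
          2 * (M₀ : ℤ) ≤ padicValRat 2 (qB * qA) ∧
          ∀ κ : ℕ, M₀ ≤ κ → 1 ≤ κ →
          ∀ (φA : Isogeny ((cubeSumCurve (3 * (p : ℚ) ^ 2)).baseChange K) ((cubeSumCurve (3 * (p : ℚ) ^ 2)).baseChange K))
            (fnA : geomTorsion ((cubeSumCurve (3 * (p : ℚ) ^ 2)).baseChange K) ((2 ^ κ * 2 ^ κ : ℕ) : ℤ) →+ geomTorsion ((cubeSumCurve (3 * (p : ℚ) ^ 2)).baseChange K) ((2 ^ κ * 2 ^ κ : ℕ) : ℤ))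
            (hfnA : ∀ (g : absoluteGaloisGroup K) (Q : geomTorsion ((cubeSumCurve (3 * (p : ℚ) ^ 2)).baseChange K) ((2 ^ κ * 2 ^ κ : ℕ) : ℤ)),
              fnA (ContinuousMonoidHom.id _ g • Q) = g • fnA Q),
            (∀ (x y : AlgebraicClosure K)
              (h : (((cubeSumCurve (3 * (p : ℚ) ^ 2)).baseChange K).baseChange (AlgebraicClosure K)).toAffine.Nonsingular x y),
              ∃ h', φA (Affine.Point.some x y h) =
                Affine.Point.some (algebraMap K (AlgebraicClosure K) ω ^ 2 * x)
                  (algebraMap K (AlgebraicClosure K) ω ^ 3 * y) h') →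
            (∀ Q : geomTorsion ((cubeSumCurve (3 * (p : ℚ) ^ 2)).baseChange K) ((2 ^ κ * 2 ^ κ : ℕ) : ℤ),
              ((fnA Q : geomTorsion ((cubeSumCurve (3 * (p : ℚ) ^ 2)).baseChange K) ((2 ^ κ * 2 ^ κ : ℕ) : ℤ)) : geomPoints ((cubeSumCurve (3 * (p : ℚ) ^ 2)).baseChange K)) = φA Q) →
          ∀ (φB : Isogeny ((cubeSumCurve (p : ℚ)).baseChange K) ((cubeSumCurve (p : ℚ)).baseChange K))
            (fnB : geomTorsion ((cubeSumCurve (p : ℚ)).baseChange K) ((2 ^ κ * 2 ^ κ : ℕ) : ℤ) →+ geomTorsion ((cubeSumCurve (p : ℚ)).baseChange K) ((2 ^ κ * 2 ^ κ : ℕ) : ℤ))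
            (hfnB : ∀ (g : absoluteGaloisGroup K) (Q : geomTorsion ((cubeSumCurve (p : ℚ)).baseChange K) ((2 ^ κ * 2 ^ κ : ℕ) : ℤ)),
              fnB (ContinuousMonoidHom.id _ g • Q) = g • fnB Q),
            (∀ (x y : AlgebraicClosure K)
              (h : (((cubeSumCurve (p : ℚ)).baseChange K).baseChange (AlgebraicClosure K)).toAffine.Nonsingular x y),
              ∃ h', φB (Affine.Point.some x y h) =
                Affine.Point.some (algebraMap K (AlgebraicClosure K) ω ^ 2 * x)
                  (algebraMap K (AlgebraicClosure K) ω ^ 3 * y) h') →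
            (∀ Q : geomTorsion ((cubeSumCurve (p : ℚ)).baseChange K) ((2 ^ κ * 2 ^ κ : ℕ) : ℤ),
              ((fnB Q : geomTorsion ((cubeSumCurve (p : ℚ)).baseChange K) ((2 ^ κ * 2 ^ κ : ℕ) : ℤ)) : geomPoints ((cubeSumCurve (p : ℚ)).baseChange K)) = φB Q) →
          ∀ (eA : geomTorsion ((cubeSumCurve (3 * (p : ℚ) ^ 2)).baseChange K) ((2 ^ κ * 2 ^ κ : ℕ) : ℤ) → geomTorsion ((cubeSumCurve (3 * (p : ℚ) ^ 2)).baseChange K) ((2 ^ κ * 2 ^ κ : ℕ) : ℤ) → AlgebraicClosure K)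
            (hμA : ∀ S T, eA S T ^ (2 ^ κ * 2 ^ κ) = 1)
            (hadd₁A : ∀ S₁ S₂ T, eA (S₁ + S₂) T = eA S₁ T * eA S₂ T)
            (hadd₂A : ∀ S T₁ T₂, eA S (T₁ + T₂) = eA S T₁ * eA S T₂)
            (hgalA : ∀ (σ : absoluteGaloisGroup K) (S T : geomTorsion ((cubeSumCurve (3 * (p : ℚ) ^ 2)).baseChange K) ((2 ^ κ * 2 ^ κ : ℕ) : ℤ)),
              σ • eA S T = eA (σ • S) (σ • T)),
            (∀ T, eA T T = 1) → (∀ T, (∀ S, eA S T = 1) → T = 0) →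
          ∀ (eB : geomTorsion ((cubeSumCurve (p : ℚ)).baseChange K) ((2 ^ κ * 2 ^ κ : ℕ) : ℤ) → geomTorsion ((cubeSumCurve (p : ℚ)).baseChange K) ((2 ^ κ * 2 ^ κ : ℕ) : ℤ) → AlgebraicClosure K)
            (hμB : ∀ S T, eB S T ^ (2 ^ κ * 2 ^ κ) = 1)
            (hadd₁B : ∀ S₁ S₂ T, eB (S₁ + S₂) T = eB S₁ T * eB S₂ T)
            (hadd₂B : ∀ S T₁ T₂, eB S (T₁ + T₂) = eB S T₁ * eB S T₂)
            (hgalB : ∀ (σ : absoluteGaloisGroup K) (S T : geomTorsion ((cubeSumCurve (p : ℚ)).baseChange K) ((2 ^ κ * 2 ^ κ : ℕ) : ℤ)),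
              σ • eB S T = eB (σ • S) (σ • T)),
            (∀ T, eB T T = 1) → (∀ T, (∀ S, eB S T = 1) → T = 0) →
          ∃ (Kol : ℕ → Prop)
            (AdmA : Set (galH1Torsion ((cubeSumCurve (3 * (p : ℚ) ^ 2)).baseChange K) ((2 ^ κ * 2 ^ κ : ℕ) : ℤ)))
            (AdmB : Set (galH1Torsion ((cubeSumCurve (p : ℚ)).baseChange K) ((2 ^ κ * 2 ^ κ : ℕ) : ℤ)))
            (x : galH1Torsion ((cubeSumCurve (p : ℚ)).baseChange K) ((2 ^ κ * 2 ^ κ : ℕ) : ℤ))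
            (cA : ℕ → galH1Torsion ((cubeSumCurve (3 * (p : ℚ) ^ 2)).baseChange K) ((2 ^ κ * 2 ^ κ : ℕ) : ℤ))
            (cB : ℕ → galH1Torsion ((cubeSumCurve (p : ℚ)).baseChange K) ((2 ^ κ * 2 ^ κ : ℕ) : ℤ))
            (yA : galH1Torsion (cubeSumCurve (3 * (p : ℚ) ^ 2)) ((2 ^ κ * 2 ^ κ : ℕ) : ℤ))
            (yB : galH1Torsion (cubeSumCurve (p : ℚ)) ((2 ^ κ * 2 ^ κ : ℕ) : ℤ)),
            -- the Kolyvagin primes OF THIS LEVEL: rational primes inert in `K`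
            (∀ ℓ, Kol ℓ → ℓ.Prime ∧ (Ideal.span {(ℓ : 𝓞 K)}).IsPrime) ∧
            -- (T-L5) the bottom class `x = δ x₀` of exact order, `c_B 1 = 2^{M₀} x`
            x = kummerMapTorsion ((cubeSumCurve (p : ℚ)).baseChange K) ((2 ^ κ * 2 ^ κ : ℕ) : ℤ)
              (((cubeSumCurve (p : ℚ)).baseChange K).zsmul_geomPoints_surjective_of_charZero
                (Int.natCast_ne_zero.mpr (mul_ne_zero (pow_ne_zero κ two_ne_zero) (pow_ne_zero κ two_ne_zero)))) x₀ ∧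
            ((2 : ℤ) ^ (2 * κ - 1)) • x ≠ 0 ∧ cB 1 = ((2 : ℤ) ^ M₀) • x ∧
            -- admissibility (the rows' ONE set per curve; `0` and the restrictions from `ℚ` belong to it)
            (∀ n, KolSupp Kol n → Odd n.primeFactors.card → cA n ∈ AdmA) ∧
            (∀ n, KolSupp Kol n → Even n.primeFactors.card → cB n ∈ AdmB) ∧
            (0 : galH1Torsion ((cubeSumCurve (3 * (p : ℚ) ^ 2)).baseChange K) ((2 ^ κ * 2 ^ κ : ℕ) : ℤ)) ∈ AdmA ∧ (0 : galH1Torsion ((cubeSumCurve (p : ℚ)).baseChange K) ((2 ^ κ * 2 ^ κ : ℕ) : ℤ)) ∈ AdmB ∧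
            (∀ u ∈ selmerGroup (cubeSumCurve (3 * (p : ℚ) ^ 2)) ((2 ^ κ * 2 ^ κ : ℕ) : ℤ), resTorsion (cubeSumCurve (3 * (p : ℚ) ^ 2)) K ((2 ^ κ * 2 ^ κ : ℕ) : ℤ) u ∈ AdmA) ∧
            (∀ u ∈ selmerGroup (cubeSumCurve (p : ℚ)) ((2 ^ κ * 2 ^ κ : ℕ) : ℤ), resTorsion (cubeSumCurve (p : ℚ)) K ((2 ^ κ * 2 ^ κ : ℕ) : ℤ) u ∈ AdmB) ∧
            -- (T-L1) the two FLIPs with multiples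
            (∀ ℓ m, Kol ℓ → KolSupp Kol (ℓ * m) → Even m.primeFactors.card →
              ∀ v : HeightOneSpectrum (𝓞 K), (ℓ : 𝓞 K) ∈ v.asIdeal → ∀ a : ℕ,
              (((2 : ℤ) ^ a) • cA (ℓ * m) ∈ selmerLocalKer ((cubeSumCurve (3 * (p : ℚ) ^ 2)).baseChange K)
                  (v.adicCompletion K) ((2 ^ κ * 2 ^ κ : ℕ) : ℤ) ↔
                ((2 : ℤ) ^ a) • cB m ∈ ((cubeSumCurve (p : ℚ)).baseChange K).torsionLocalKer
                  (v.adicCompletion K) ((2 ^ κ * 2 ^ κ : ℕ) : ℤ))) ∧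
            (∀ ℓ m, Kol ℓ → KolSupp Kol (ℓ * m) → Odd m.primeFactors.card →
              ∀ v : HeightOneSpectrum (𝓞 K), (ℓ : 𝓞 K) ∈ v.asIdeal → ∀ a : ℕ,
              (((2 : ℤ) ^ a) • cB (ℓ * m) ∈ selmerLocalKer ((cubeSumCurve (p : ℚ)).baseChange K)
                  (v.adicCompletion K) ((2 ^ κ * 2 ^ κ : ℕ) : ℤ) ↔
                ((2 : ℤ) ^ a) • cA m ∈ ((cubeSumCurve (3 * (p : ℚ) ^ 2)).baseChange K).torsionLocalKer
                  (v.adicCompletion K) ((2 ^ κ * 2 ^ κ : ℕ) : ℤ))) ∧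
            -- (T-L1) Selmer away from `λ` and the places over `m` (McCallum Lemma 4.3)
            (∀ ℓ m : ℕ, Kol ℓ → KolSupp Kol (ℓ * m) → ¬ ℓ ∣ m →
              ∀ v₀ : HeightOneSpectrum (𝓞 K), (ℓ : 𝓞 K) ∈ v₀.asIdeal →
              ∀ v : Place K, v ≠ Sum.inr v₀ →
                (∀ q : HeightOneSpectrum (𝓞 K), (∃ r ∈ m.primeFactors, (r : 𝓞 K) ∈ q.asIdeal) →
                  v ≠ Sum.inr q) →
                cA (ℓ * m) ∈ selmerLocalKer ((cubeSumCurve (3 * (p : ℚ) ^ 2)).baseChange K) (Place.Completion v) ((2 ^ κ * 2 ^ κ : ℕ) : ℤ)) ∧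
            (∀ ℓ m : ℕ, Kol ℓ → KolSupp Kol (ℓ * m) → ¬ ℓ ∣ m →
              ∀ v₀ : HeightOneSpectrum (𝓞 K), (ℓ : 𝓞 K) ∈ v₀.asIdeal →
              ∀ v : Place K, v ≠ Sum.inr v₀ →
                (∀ q : HeightOneSpectrum (𝓞 K), (∃ r ∈ m.primeFactors, (r : 𝓞 K) ∈ q.asIdeal) →
                  v ≠ Sum.inr q) →
                cB (ℓ * m) ∈ selmerLocalKer ((cubeSumCurve (p : ℚ)).baseChange K) (Place.Completion v) ((2 ^ κ * 2 ^ κ : ℕ) : ℤ)) ∧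
            -- the Kolyvagin primes' level: `X[4^κ] ⊆ X(K_q)`
            (∀ r : ℕ, Kol r → ∀ q : HeightOneSpectrum (𝓞 K), (r : 𝓞 K) ∈ q.asIdeal →
              ∀ (g : absoluteGaloisGroup (Place.Completion (Sum.inr q : Place K)))
                (Q : geomTorsion ((cubeSumCurve (3 * (p : ℚ) ^ 2)).baseChange K) ((2 ^ κ * 2 ^ κ : ℕ) : ℤ)),
                absGaloisRestrict K (Place.Completion (Sum.inr q : Place K)) g • Q = Q) ∧
            (∀ r : ℕ, Kol r → ∀ q : HeightOneSpectrum (𝓞 K), (r : 𝓞 K) ∈ q.asIdeal →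
              ∀ (g : absoluteGaloisGroup (Place.Completion (Sum.inr q : Place K)))
                (Q : geomTorsion ((cubeSumCurve (p : ℚ)).baseChange K) ((2 ^ κ * 2 ^ κ : ℕ) : ℤ)),
                absGaloisRestrict K (Place.Completion (Sum.inr q : Place K)) g • Q = Q) ∧
            -- (T-L2)′ LOCAL LEAVES, 𝒪-LINE form: NOT BOTH local terms (over `t`, over `w_X t`) vanish
            (∀ ℓ m : ℕ, Kol ℓ → KolSupp Kol (ℓ * m) → ¬ ℓ ∣ m → Even m.primeFactors.card →
              ∀ (j N' a b : ℕ) (t : galH1Torsion ((cubeSumCurve (3 * (p : ℚ) ^ 2)).baseChange K) ((2 ^ κ * 2 ^ κ : ℕ) : ℤ))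
                (ht : t ∈ selmerGroup ((cubeSumCurve (3 * (p : ℚ) ^ 2)).baseChange K) ((2 ^ κ * 2 ^ κ : ℕ) : ℤ))
                (hz : ((2 : ℤ) ^ j) • cA (ℓ * m) ∈ selmerGroup ((cubeSumCurve (3 * (p : ℚ) ^ 2)).baseChange K) ((2 ^ κ * 2 ^ κ : ℕ) : ℤ)),
                ((2 : ℤ) ^ N') • t = 0 →
                (∀ q ∈ m.primeFactors, ∀ v : HeightOneSpectrum (𝓞 K), (q : 𝓞 K) ∈ v.asIdeal →
                  t ∈ ((cubeSumCurve (3 * (p : ℚ) ^ 2)).baseChange K).torsionLocalKer (v.adicCompletion K) ((2 ^ κ * 2 ^ κ : ℕ) : ℤ)) →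
                κ ≤ j → N' ≤ κ → N' ≤ j → a + b + 1 = N' →
                (∀ v : HeightOneSpectrum (𝓞 K), (ℓ : 𝓞 K) ∈ v.asIdeal →
                  ((2 : ℤ) ^ (a + (j - N'))) • cB m ∉
                    ((cubeSumCurve (p : ℚ)).baseChange K).torsionLocalKer (v.adicCompletion K) ((2 ^ κ * 2 ^ κ : ℕ) : ℤ)) →
                (∀ v : HeightOneSpectrum (𝓞 K), (ℓ : 𝓞 K) ∈ v.asIdeal → ((2 : ℤ) ^ b) • t ∉
                  ((cubeSumCurve (3 * (p : ℚ) ^ 2)).baseChange K).torsionLocalKer (v.adicCompletion K) ((2 ^ κ * 2 ^ κ : ℕ) : ℤ)) →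
                ∀ v₀ : HeightOneSpectrum (𝓞 K), (ℓ : 𝓞 K) ∈ v₀.asIdeal →
                (∀ D : FirstCaseData ((cubeSumCurve (3 * (p : ℚ) ^ 2)).baseChange K) (2 ^ κ), D.b₁ = ((2 : ℤ) ^ (j - κ)) • cA (ℓ * m) →
                  galoisCohomology.map (inclKD ((cubeSumCurve (3 * (p : ℚ) ^ 2)).baseChange K) (2 ^ κ) (2 ^ κ)) 1 D.b' = t →
                  D.localTerm eA hμA hadd₁A hadd₂A hgalA
                    (LocalInvariants.canonical K (2 ^ κ * 2 ^ κ)) (Sum.inr v₀) = 0) →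
                (∀ D : FirstCaseData ((cubeSumCurve (3 * (p : ℚ) ^ 2)).baseChange K) (2 ^ κ), D.b₁ = ((2 : ℤ) ^ (j - κ)) • cA (ℓ * m) →
                  galoisCohomology.map (inclKD ((cubeSumCurve (3 * (p : ℚ) ^ 2)).baseChange K) (2 ^ κ) (2 ^ κ)) 1 D.b' =
                    resH1Hom (ContinuousMonoidHom.id _) fnA hfnA t →
                  D.localTerm eA hμA hadd₁A hadd₂A hgalA
                    (LocalInvariants.canonical K (2 ^ κ * 2 ^ κ)) (Sum.inr v₀) = 0) →
                False) ∧
            (∀ ℓ m : ℕ, Kol ℓ → KolSupp Kol (ℓ * m) → ¬ ℓ ∣ m → Odd m.primeFactors.card →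
              ∀ (j N' a b : ℕ) (t : galH1Torsion ((cubeSumCurve (p : ℚ)).baseChange K) ((2 ^ κ * 2 ^ κ : ℕ) : ℤ))
                (ht : t ∈ selmerGroup ((cubeSumCurve (p : ℚ)).baseChange K) ((2 ^ κ * 2 ^ κ : ℕ) : ℤ))
                (hz : ((2 : ℤ) ^ j) • cB (ℓ * m) ∈ selmerGroup ((cubeSumCurve (p : ℚ)).baseChange K) ((2 ^ κ * 2 ^ κ : ℕ) : ℤ)),
                ((2 : ℤ) ^ N') • t = 0 →
                (∀ q ∈ m.primeFactors, ∀ v : HeightOneSpectrum (𝓞 K), (q : 𝓞 K) ∈ v.asIdeal →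
                  t ∈ ((cubeSumCurve (p : ℚ)).baseChange K).torsionLocalKer (v.adicCompletion K) ((2 ^ κ * 2 ^ κ : ℕ) : ℤ)) →
                κ ≤ j → N' ≤ κ → N' ≤ j → a + b + 1 = N' →
                (∀ v : HeightOneSpectrum (𝓞 K), (ℓ : 𝓞 K) ∈ v.asIdeal →
                  ((2 : ℤ) ^ (a + (j - N'))) • cA m ∉
                    ((cubeSumCurve (3 * (p : ℚ) ^ 2)).baseChange K).torsionLocalKer (v.adicCompletion K) ((2 ^ κ * 2 ^ κ : ℕ) : ℤ)) →
                (∀ v : HeightOneSpectrum (𝓞 K), (ℓ : 𝓞 K) ∈ v.asIdeal → ((2 : ℤ) ^ b) • t ∉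
                  ((cubeSumCurve (p : ℚ)).baseChange K).torsionLocalKer (v.adicCompletion K) ((2 ^ κ * 2 ^ κ : ℕ) : ℤ)) →
                ∀ v₀ : HeightOneSpectrum (𝓞 K), (ℓ : 𝓞 K) ∈ v₀.asIdeal →
                (∀ D : FirstCaseData ((cubeSumCurve (p : ℚ)).baseChange K) (2 ^ κ), D.b₁ = ((2 : ℤ) ^ (j - κ)) • cB (ℓ * m) →
                  galoisCohomology.map (inclKD ((cubeSumCurve (p : ℚ)).baseChange K) (2 ^ κ) (2 ^ κ)) 1 D.b' = t →
                  D.localTerm eB hμB hadd₁B hadd₂B hgalB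
                    (LocalInvariants.canonical K (2 ^ κ * 2 ^ κ)) (Sum.inr v₀) = 0) →
                (∀ D : FirstCaseData ((cubeSumCurve (p : ℚ)).baseChange K) (2 ^ κ), D.b₁ = ((2 : ℤ) ^ (j - κ)) • cB (ℓ * m) →
                  galoisCohomology.map (inclKD ((cubeSumCurve (p : ℚ)).baseChange K) (2 ^ κ) (2 ^ κ)) 1 D.b' =
                    resH1Hom (ContinuousMonoidHom.id _) fnB hfnB t →
                  D.localTerm eB hμB hadd₁B hadd₂B hgalB
                    (LocalInvariants.canonical K (2 ^ κ * 2 ^ κ)) (Sum.inr v₀) = 0) →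
                False) ∧
            -- (T-L3) the MIXED Čebotarev clause (memo Cor. 3.2″) for `w_X := resH1Hom id fn_X hfn_X`
            (∀ (TA : Finset (galH1Torsion ((cubeSumCurve (3 * (p : ℚ) ^ 2)).baseChange K) ((2 ^ κ * 2 ^ κ : ℕ) : ℤ)))
              (TB : Finset (galH1Torsion ((cubeSumCurve (p : ℚ)).baseChange K) ((2 ^ κ * 2 ^ κ : ℕ) : ℤ)))
              (gA : galH1Torsion ((cubeSumCurve (3 * (p : ℚ) ^ 2)).baseChange K) ((2 ^ κ * 2 ^ κ : ℕ) : ℤ))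
              (gB : galH1Torsion ((cubeSumCurve (p : ℚ)).baseChange K) ((2 ^ κ * 2 ^ κ : ℕ) : ℤ)),
              gA ∈ AdmA → gB ∈ AdmB → (↑TA : Set _) ⊆ AdmA → (↑TB : Set _) ⊆ AdmB → ∀ b : ℕ,
              ∃ ℓ, b < ℓ ∧ Kol ℓ ∧
              (∀ g ∈ AddSubgroup.closure (insert gA (insert (resH1Hom (ContinuousMonoidHom.id _) fnA hfnA gA)
                  ((TA : Set _) ∪ resH1Hom (ContinuousMonoidHom.id _) fnA hfnA '' (TA : Set _)))),
                (∀ v : HeightOneSpectrum (𝓞 K), (ℓ : 𝓞 K) ∈ v.asIdeal →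
                  g ∈ ((cubeSumCurve (3 * (p : ℚ) ^ 2)).baseChange K).torsionLocalKer (v.adicCompletion K)
                    ((2 ^ κ * 2 ^ κ : ℕ) : ℤ)) ↔
                g ∈ AddSubgroup.closure ((TA : Set _) ∪ resH1Hom (ContinuousMonoidHom.id _) fnA hfnA '' (TA : Set _))) ∧
              (∀ g ∈ AddSubgroup.closure (insert gB (insert (resH1Hom (ContinuousMonoidHom.id _) fnB hfnB gB)
                  ((TB : Set _) ∪ resH1Hom (ContinuousMonoidHom.id _) fnB hfnB '' (TB : Set _)))),
                (∀ v : HeightOneSpectrum (𝓞 K), (ℓ : 𝓞 K) ∈ v.asIdeal →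
                  g ∈ ((cubeSumCurve (p : ℚ)).baseChange K).torsionLocalKer (v.adicCompletion K)
                    ((2 ^ κ * 2 ^ κ : ℕ) : ℤ)) ↔
                g ∈ AddSubgroup.closure ((TB : Set _) ∪ resH1Hom (ContinuousMonoidHom.id _) fnB hfnB '' (TB : Set _)))) ∧
            -- the `ℚ`-KUMMER inputs of the lifts (#K11's five, `T := 2κ`) for `A` and for `B`
            yA ∈ selmerGroup (cubeSumCurve (3 * (p : ℚ) ^ 2)) ((2 ^ κ * 2 ^ κ : ℕ) : ℤ) ∧ torsionH1ToH1 (cubeSumCurve (3 * (p : ℚ) ^ 2)) ((2 ^ κ * 2 ^ κ : ℕ) : ℤ) yA = 0 ∧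
            (∀ a : ℤ, a • yA = 0 → ((2 : ℤ) ^ (2 * κ) ∣ a) ∨ yA = 0) ∧
            (∀ u ∈ selmerGroup (cubeSumCurve (3 * (p : ℚ) ^ 2)) ((2 ^ κ * 2 ^ κ : ℕ) : ℤ), torsionH1ToH1 (cubeSumCurve (3 * (p : ℚ) ^ 2)) ((2 ^ κ * 2 ^ κ : ℕ) : ℤ) u = 0 → ∃ a : ℤ, u = a • yA) ∧
            yB ∈ selmerGroup (cubeSumCurve (p : ℚ)) ((2 ^ κ * 2 ^ κ : ℕ) : ℤ) ∧ torsionH1ToH1 (cubeSumCurve (p : ℚ)) ((2 ^ κ * 2 ^ κ : ℕ) : ℤ) yB = 0 ∧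
            (∀ a : ℤ, a • yB = 0 → ((2 : ℤ) ^ (2 * κ) ∣ a) ∨ yB = 0) ∧
            (∀ u ∈ selmerGroup (cubeSumCurve (p : ℚ)) ((2 ^ κ * 2 ^ κ : ℕ) : ℤ), torsionH1ToH1 (cubeSumCurve (p : ℚ)) ((2 ^ κ * 2 ^ κ : ℕ) : ℤ) u = 0 → ∃ a : ℤ, u = a • yB)) :
    PublishedFactsTwoPlus →
    ∀ (p : ℕ), p.Prime → p % 9 = 7 → (¬ ∃ x : ZMod p, x ^ 3 = 3) →
      ∀ (A B : WeierstrassCurve ℚ) [A.IsElliptic] [A.IsGloballyMinimal] [B.IsElliptic]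
        [B.IsGloballyMinimal], (∃ C : VariableChange ℚ, C • B = HuShuYin2019.cubeSumCurve (p : ℚ)) →
        (∃ C : VariableChange ℚ, C • A = HuShuYin2019.cubeSumCurve (3 * (p : ℚ) ^ 2)) →
        4 < Nat.card (AddCommGroup.primaryComponent B.sha 2) *
            Nat.card (AddCommGroup.primaryComponent A.sha 2) →
        ∃ qB qA : ℚ, shaAn B = (qB : ℂ) ∧ shaAn A = (qA : ℂ) ∧ qB * qA ≠ 0 ∧
          (padicValNat 2 (Nat.card (AddCommGroup.primaryComponent B.sha 2)) : ℤ) +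
              (padicValNat 2 (Nat.card (AddCommGroup.primaryComponent A.sha 2)) : ℤ) ≤
            padicValRat 2 (qB * qA) := by
  refine tailSeven_of_coupledTelescope_of_leaves_kappa ?_
  intro hF p hp h9 h3 A B _ _ _ _ hB hA h4 qB qA hqB hqA hne K _ _ ω hω h2 CB hCB P Y hPinf hPgen hht
  obtain ⟨M₀, x₀, T, hT, hY, hM₀, hlevel⟩ :=
    hR hF p hp h9 h3 A B hB hA h4 qB qA hqB hqA hne K ω hω h2 CB hCB P Y hPinf hPgen hht
  obtain ⟨CA, hCA⟩ := hA
  -- ### the short models are elliptic; `Ш(·/ℚ)[2^∞]`, `Ш(·_K/K)[2^∞]` are finite (the guard + LEMMA K0)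
  haveI : (cubeSumCurve (p : ℚ)).IsElliptic := hCB ▸ inferInstance
  haveI : (cubeSumCurve (3 * (p : ℚ) ^ 2)).IsElliptic := hCA ▸ inferInstance
  have hBne : Nat.card (AddCommGroup.primaryComponent B.sha 2) ≠ 0 := fun h ↦ by
    rw [h, zero_mul] at h4; exact Nat.not_lt_zero _ h4
  have hAne : Nat.card (AddCommGroup.primaryComponent A.sha 2) ≠ 0 := fun h ↦ by
    rw [h, mul_zero] at h4; exact Nat.not_lt_zero _ h4
  have hcB := natCard_primaryComponent_sha_eq_of_variableChange hCB 2
  have hcA := natCard_primaryComponent_sha_eq_of_variableChange hCA 2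
  haveI : Finite (AddCommGroup.primaryComponent (cubeSumCurve (p : ℚ)).sha 2) :=
    Nat.finite_of_card_ne_zero (by rw [← hcB]; exact hBne)
  haveI : Finite (AddCommGroup.primaryComponent (cubeSumCurve (3 * (p : ℚ) ^ 2)).sha 2) :=
    Nat.finite_of_card_ne_zero (by rw [← hcA]; exact hAne)
  haveI : Finite (AddCommGroup.primaryComponent ((cubeSumCurve (p : ℚ)).baseChange K).sha 2) :=
    Nat.finite_of_card_ne_zero (ne_of_eq_of_ne
      (SylvesterTwoShaDescentOrderForm.natCard_primaryComponent_sha_baseChange_eq_sq_of_omega K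
        (b := -432 * (p : ℚ) ^ 2) hCB hω h2) (pow_ne_zero 2 hBne))
  haveI : Finite (AddCommGroup.primaryComponent ((cubeSumCurve (3 * (p : ℚ) ^ 2)).baseChange K).sha 2) :=
    Nat.finite_of_card_ne_zero (ne_of_eq_of_ne
      (SylvesterTwoShaDescentOrderForm.natCard_primaryComponent_sha_baseChange_eq_sq_of_omega K
        (b := -432 * (3 * (p : ℚ) ^ 2) ^ 2) hCA hω h2) (pow_ne_zero 2 hAne))
  -- ### the level `κ ≥ max(M₀, 1)` killing the four `2`-primary parts
  obtain ⟨k₁, hk₁⟩ := exists_pow_nsmul_primaryComponent_eq_zero (G := (cubeSumCurve (p : ℚ)).sha) 2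
  obtain ⟨k₂, hk₂⟩ := exists_pow_nsmul_primaryComponent_eq_zero (G := ((cubeSumCurve (p : ℚ)).baseChange K).sha) 2
  obtain ⟨k₃, hk₃⟩ := exists_pow_nsmul_primaryComponent_eq_zero (G := (cubeSumCurve (3 * (p : ℚ) ^ 2)).sha) 2
  obtain ⟨k₄, hk₄⟩ := exists_pow_nsmul_primaryComponent_eq_zero (G := ((cubeSumCurve (3 * (p : ℚ) ^ 2)).baseChange K).sha) 2
  obtain ⟨κ, hκM, hκ1, hκ₁, hκ₂, hκ₃, hκ₄⟩ : ∃ κ, M₀ ≤ κ ∧ 1 ≤ κ ∧ k₁ ≤ κ ∧ k₂ ≤ κ ∧ k₃ ≤ κ ∧ k₄ ≤ κ :=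
    ⟨M₀ + 1 + k₁ + k₂ + k₃ + k₄, by omega, by omega, by omega, by omega, by omega, by omega⟩
  -- ### the per-curve OBJECTS (file XVI) and the rows' level-`κ` data (hR)
  obtain ⟨φA, fnA, hfnA, rA, wA, eA, hμA, hadd₁A, hadd₂A, hgalA, haltA, hleA, BA, ιA, PA, LA, hφA, hfnAφ,
      hrA, hwA, hwSA, hwSelA, hbijA, hwA', hndA, hBA, hιA, hPA, -, hisoA, hcoA⟩ :=
    exists_curve_package (cubeSumCurve (3 * (p : ℚ) ^ 2)) K rfl rfl rfl rfl hω h2 κ hκ1 (pow_nsmul_primaryComponent_eq_zero_of_le hk₃ hκ₃)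
      (pow_nsmul_primaryComponent_eq_zero_of_le hk₄ hκ₄) hvii hH3 hLP
  obtain ⟨φB, fnB, hfnB, rB, wB, eB, hμB, hadd₁B, hadd₂B, hgalB, haltB, hleB, BB, ιB, PB, LB, hφB, hfnBφ,
      hrB, hwB, hwSB, hwSelB, hbijB, hwB', hndB, hBB, hιB, hPB, -, hisoB, hcoB⟩ :=
    exists_curve_package (cubeSumCurve (p : ℚ)) K rfl rfl rfl rfl hω h2 κ hκ1 (pow_nsmul_primaryComponent_eq_zero_of_le hk₁ hκ₁)
      (pow_nsmul_primaryComponent_eq_zero_of_le hk₂ hκ₂) hvii hH3 hLP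
  obtain ⟨Kol, AdmA, AdmB, x, cA, cB, yA, yB, hKol, hx, x_ord, c_one, cA_adm, cB_adm, h0A, h0B, hresA, hresB, flipA,
      flipB, hcSelA, hcSelB, htrivA, htrivB, hlocA, hlocB, hCeb, hyA, hτyA, hfreeA, hkerA, hyB, hτyB, hfreeB,
      hkerB⟩ :=
    hlevel κ hκM hκ1 φA fnA hfnA hφA hfnAφ φB fnB hfnB hφB hfnBφ eA hμA hadd₁A hadd₂A hgalA haltA hndA eB
      hμB hadd₁B hadd₂B hgalB haltB hndB
  -- ### the two LIFT FAMILIES (file XIV) and the TAIL BLOCK (XVII-a)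
  obtain ⟨mA, sA₁, NA₁, hSelA₁, hAdmA₁, hzeroA, hNA₁, hexA, hleA₁, himgA, hindA₁, hgenA₁⟩ :=
    exists_lift_family_tree (cubeSumCurve (3 * (p : ℚ) ^ 2)) K κ φA fnA hfnA rA wA hrA hwA hwSA hbijA LA
      (pow_nsmul_primaryComponent_eq_zero_of_le hk₃ hκ₃) AdmA h0A hresA yA hyA hτyA hfreeA hkerA 0
  obtain ⟨mB, sB₁, NB₁, hSelB₁, hAdmB₁, hzeroB, hNB₁, hexB, hleB₁, himgB, hindB₁, hgenB₁⟩ :=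
    exists_lift_family_tree (cubeSumCurve (p : ℚ)) K κ φB fnB hfnB rB wB hrB hwB hwSB hbijB LB
      (pow_nsmul_primaryComponent_eq_zero_of_le hk₁ hκ₁) AdmB h0B hresB yB hyB hτyB hfreeB hkerB x₀
  rw [← hx] at hindB₁
  obtain ⟨K₀, sA, sB, N, hselA, hselB, sA_adm, sB_adm, htail⟩ :=
    exists_tailBlock _ _ AdmA AdmB _ _ hwSelA hwSelB
      (torsionH1ToH1 ((cubeSumCurve (3 * (p : ℚ) ^ 2)).baseChange K) ((2 ^ κ * 2 ^ κ : ℕ) : ℤ)) (torsionH1ToH1 ((cubeSumCurve (p : ℚ)).baseChange K) ((2 ^ κ * 2 ^ κ : ℕ) : ℤ))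
      (((cubeSumCurve (3 * (p : ℚ) ^ 2)).baseChange K).sha.subtype.comp (AddCommGroup.primaryComponent ((cubeSumCurve (3 * (p : ℚ) ^ 2)).baseChange K).sha 2).subtype)
      (((cubeSumCurve (p : ℚ)).baseChange K).sha.subtype.comp (AddCommGroup.primaryComponent ((cubeSumCurve (p : ℚ)).baseChange K).sha 2).subtype)
      (fun a a' h ↦ Subtype.ext (Subtype.ext h)) (fun a a' h ↦ Subtype.ext (Subtype.ext h)) wA wB hwA' hwB'
      _ _ x κ ιA (fun z ↦ hιA z) ιB (fun z ↦ hιB z) BA BB hisoA hisoB PA PB hPA hPB hcoA hcoB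
      mA sA₁ NA₁ hSelA₁ hAdmA₁ hzeroA hNA₁ hexA hleA₁ himgA
      (fun I α β h ↦ (hindA₁ I 0 0 α β (by rwa [zero_smul, zero_smul, add_zero, zero_add])).2) hgenA₁
      mB sB₁ NB₁ hSelB₁ hAdmB₁ hzeroB hNB₁ hexB hleB₁ himgB hindB₁ hgenB₁
  -- ### the two VALUE CLAUSES (file XV′, 𝒪-line form) on the constructed pairings
  have hCTVA := valueClause_of_localLeafPair ((cubeSumCurve (3 * (p : ℚ) ^ 2)).baseChange K)
    ((cubeSumCurve (p : ℚ)).baseChange K) κ eA hμA hadd₁A hadd₂A hgalA haltA _ _ (hH3 K _) _ hleA BA hBA ιA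
    hιA PA (fun z t ↦ by rw [hPA]) wA (fun z t ↦ by rw [hPA]) fnA hfnA φA hfnAφ hwSelA hwA hwSA Kol hKol
    (fun m ↦ Even m.primeFactors.card) cA cB hcSelA htrivA hlocA
  have hCTVB := valueClause_of_localLeafPair ((cubeSumCurve (p : ℚ)).baseChange K)
    ((cubeSumCurve (3 * (p : ℚ) ^ 2)).baseChange K) κ eB hμB hadd₁B hadd₂B hgalB haltB _ _ (hH3 K _) _ hleB
    BB hBB ιB hιB PB (fun z t ↦ by rw [hPB]) wB (fun z t ↦ by rw [hPB]) fnB hfnB φB hfnBφ hwSelB hwB hwSB Kol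
    hKol (fun m ↦ Odd m.primeFactors.card) cB cA hcSelB htrivB hlocB
  exact ⟨κ, M₀, K₀, Kol, _, _, AdmA, AdmB, x₀, T, x, cA, cB, PA, PB, sA, sB, N, hselA, hselB, hwSelA,
    hwSelB, BA, _, BB, _, hKol, hκM, hT, hY, hx, x_ord, c_one, hM₀, cA_adm, cB_adm, sA_adm, sB_adm,
    flipA, flipB, hCTVA, hCTVB, hCeb, htail⟩

end Summit.BirchSwinnertonDyer.BirchSwinnertonDyer.Theorems.SylvesterTwoCoupledTelescope

end
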